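import Summits.BirchSwinnertonDyer.Rank1Residual.X1.FactorSqueeze
import Summits.BirchSwinnertonDyer.Rank1Residual.X1.CyclotomicZeros
import HarnessLib

/-!
# Route N ∘ C — the factorisation squeeze RELATIVE TO A CYCLOTOMIC FACTOR: when a point of infinite
# order over `ℚ_1` puts `ξ_p` into `f_E` (route C), only the `Λ`-divisors of `ϖ·L_p` that are
# MULTIPLES OF `ξ_p` can be `f_E`, and their `λ`'s form a smaller set `A`

HONEST FRAMING (cell `b2b-bsdres`, run/shared/lean/b2b/bsd-rank1-residual/, verbatim in every
file): the goal of the cell is to DELETE the COMBINATION-SHAPED residual classes of the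
Birch–Swinnerton-Dyer formula for ALL analytic-rank `≤ 1` elliptic curves over `ℚ` — "full BSD
formula for every rank `≤ 1` curve in class `C`" assembled STRICTLY from published theorems — so
that the rank-`≤ 1` remainder becomes exactly the CONSTRUCTION-SHAPED classes, which are TYPED
(missing-input `Prop`s), NOT attempted. This is not "finishing BSD". Sub-cell
`b2b-bsdres-eisenstein-p1` (CLASS-OWNERS row "X1 (r=0)"), gen 10: research route; NO CLAIM BEYOND
STATED CLASSES; nothing here changes a label. ONE typed def (`AnalyticLamDivisorSetXi`, nothing
asserted); everything else is a theorem over PUBLISHED named facts and the cell's typed inputs.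

WHY THIS FILE. Route N (`X1/FactorSqueeze.lean`): `λ(f_E)` is the `λ` of a `Λ`-divisor of
`g_an = f_E·h` (`ι(g_an) = ϖ·L_p`), i.e. a subset sum of the `ℚ_p`-irreducible factor degrees of the
analytic distinguished polynomial `P_an`. Route C (`X1/CyclotomicZeros.lean`): a point of infinite
order over the first layer `ℚ_1` puts `ξ_p = Φ_p(1+T)` into `f_E` (`CyclotomicFactorAt W p`, typed;
Greenberg LNM 1716 p. 132 for `34A1`). Together: `f_E` is a `Λ`-divisor of `g_an` that is a MULTIPLE
of `ξ_p`, so `λ(f_E)` lies in the smaller set `A` of degrees of the sub-products of `P_an` containing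
its `ξ_p`-factor (typed here as `AnalyticLamDivisorSetXi W p A`, certified per pair by the route-N
engines from the Newton polygon / residual polynomials of `ϖ·L_p` — `ξ_p` is the irreducible factor of
degree `p − 1` and slope `1/(p−1)`). Census example (eisenstein-p1 gen 10 + iw-1 gen 9): `6422f@3`,
`λ_an = 6`, `P_an = ξ_3 · Q_4` with `Q_4` irreducible; route N alone leaves `λ_alg ∈ {4, 6}`
(`λ_alg ≥ 3` from route T), route C alone needs `λ_an ≤ 4`; with iw-1's certified point on
`6422f1/ℚ(ζ_9)⁺` the divisor `f_E` contains `ξ_3`, so `λ(f_E) ∈ {2, 6}`, and `λ_alg ≥ 3` closes it.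

* `AnalyticLamDivisorSetXi W p A` (TYPED): "`λ(g) ∈ A` for every `Λ`-divisor `g` of `ϖ·L_p` with
  `ξ_p ∣ g`"; `AnalyticLamDivisorSetXi.of_lamDivisorSet` (an unconditional divisor set qualifies).
* `lambdaPartAt_of_lamDivisorSetXi_of_cyclotomicFactor_of_even` — the λ-part from
  `CyclotomicFactorAt`, the relative divisor set, `AlgebraicLambdaGE k`, parity and the gap check.
* `Leaf.bsdp_of_muZero_of_lamDivisorSetXi_of_cyclotomicFactor` — on the leaf, `BSD(E,p)`.

References: [Washington1997] Thm. 7.3, Prop. 7.6; [GreenbergLNM1716] Thm. 1.2, Prop. 3.10, §5 p. 132;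
[Wuthrich2014] Thm. 16; HOME/b2b-bsdres-eisenstein-p1/X1R0-GAPMAP.md §19.
-/

noncomputable section

open scoped Classical MatrixGroups ModularForm

open PowerSeries CongruenceSubgroup WeierstrassCurve Literature.NumberTheory.EllipticCurves
  Literature.NumberTheory.EllipticCurves.ModularForms
  Literature.NumberTheory.EllipticCurves.Rank1Residual
  Literature.NumberTheory.EllipticCurves.Greenberg1999
  Summit.BirchSwinnertonDyer.BirchSwinnertonDyer.Theorems.Rank1ResidualX1Defs
  Summit.BirchSwinnertonDyer.Rank1Residual.X1.MuLambda
  Summit.BirchSwinnertonDyer.Rank1Residual.X1.MuPart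
  Summit.BirchSwinnertonDyer.Rank1Residual.X1.ParitySqueeze
  Summit.BirchSwinnertonDyer.Rank1Residual.X1.TamagawaSqueeze
  Summit.BirchSwinnertonDyer.Rank1Residual.X1.FactorSqueeze
  Summit.BirchSwinnertonDyer.Rank1Residual.X1.CyclotomicZeros

set_option autoImplicit false

namespace Summit.BirchSwinnertonDyer.Rank1Residual.X1.FactorSqueezeCyclotomic

/-! ## §1. The divisor set relative to `ξ_p`, TYPED (nothing asserted) -/

/-- **"`λ(g) ∈ A` for every `Λ`-divisor `g` of `ϖ·L_p(E,T)` divisible by `ξ_p`" (TYPED; nothing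
asserted).** As `FactorSqueeze.AnalyticLamDivisorSet` but restricted to divisors that are multiples
of `ξ_p = Φ_p(1+T)` (`CyclotomicZeros.xi`). CERTIFICATE (outside the kernel): the degrees of the
sub-products of the `ℚ_p`-irreducible factorisation of the distinguished polynomial `P_an` of `ϖ·L_p`
that CONTAIN its (unique, Eisenstein) factor `ξ_p`; computed per pair by the route-N engines.
[cite: Washington1997, Thm. 7.3 and Prop. 7.6 (shape only; nothing asserted)] -/
def AnalyticLamDivisorSetXi (W : WeierstrassCurve ℚ) [W.IsElliptic] [W.IsGloballyMinimal] (p : ℕ)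
    [Fact p.Prime] (A : Set ℕ) : Prop :=
  ∀ [NeZero (W.conductorNorm ℤ)] (f : CuspForm (Gamma0 (W.conductorNorm ℤ)) 2),
    IsNewformOf W f → ∀ (ϖ : ℚ), (ϖ : ℝ) * W.realPeriodRat = plusPeriod f →
    ∀ (g h : IwasawaAlgebra p),
      iwasawaToPowerSeries p (g * h) = C (ϖ : ℚ_[p]) * padicLFunction f (unitRoot W p : ℚ_[p]) →
      xi p ∣ g → lam g ∈ A

section Basic

variable {W : WeierstrassCurve ℚ} [W.IsElliptic] [W.IsGloballyMinimal] {p : ℕ} [Fact p.Prime]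

/-- An unconditional divisor set is in particular a divisor set relative to `ξ_p`. [folklore] -/
theorem AnalyticLamDivisorSetXi.of_lamDivisorSet {A : Set ℕ} (hA : AnalyticLamDivisorSet W p A) :
    AnalyticLamDivisorSetXi W p A :=
  fun f hf ϖ hϖ g h hι _ ↦ hA f hf ϖ hϖ g h hι

/-- Monotonicity in the set. [folklore] -/
theorem AnalyticLamDivisorSetXi.mono {A B : Set ℕ} (hAB : A ⊆ B)
    (hA : AnalyticLamDivisorSetXi W p A) : AnalyticLamDivisorSetXi W p B :=
  fun f hf ϖ hϖ g h hι hξ ↦ hAB (hA f hf ϖ hϖ g h hι hξ)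

end Basic

/-! ## §2. Route N ∘ C: the λ-part from a cyclotomic factor and the relative divisor set -/

section Squeeze

variable {W : WeierstrassCurve ℚ} [W.IsElliptic] [W.IsGloballyMinimal] {p : ℕ} [Fact p.Prime]

/-- **Route N ∘ C, λ-part with parity.** `W/ℚ` globally minimal elliptic, `p ≠ 2` good ordinary with
`E[p]` reducible, `Sel_{p^∞}(E/ℚ)` finite; granted Wuthrich Thm. 16 (`hW16`) and Greenberg
Prop. 3.10 (`h310`), both PUBLISHED: if `λ_an = n` is even (`AnalyticLambdaEq W p n`), `ξ_p ∣ f_E`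
(`CyclotomicFactorAt W p`, route C's typed input), every `ξ_p`-multiple `Λ`-divisor of `ϖ·L_p` has
`λ ∈ A` (`AnalyticLamDivisorSetXi W p A`), `λ_alg ≥ k` (`AlgebraicLambdaGE W p k`) and the gap check
`∀ d ∈ A, Even d → k ≤ d → n ≤ d + 1` passes, then `LambdaPartAt W p`.
[cite: GreenbergLNM1716, Thm. 1.2, Prop. 3.10 and §5 p. 132] [cite: Wuthrich2014, Thm. 16 (p. 397)]
[cite: Washington1997, Thm. 7.3 and Prop. 7.6] -/
theorem lambdaPartAt_of_lamDivisorSetXi_of_cyclotomicFactor_of_even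
    (hW16 : Wuthrich2014.charIdeal_dvd_padicLFunction)
    (h310 : prop310_selmerCorank_mod_two_eq_lambdaInvariant)
    (hp : p ≠ 2) (hgood : W.HasGoodReductionAtPrime p) (hord : ¬ (p : ℤ) ∣ W.frobeniusTrace p)
    (hred : ¬ W.HasIrreducibleModPGaloisRep p) (hSel : Finite (W.selmerGroupPInfty p))
    {n k : ℕ} {A : Set ℕ} (hn : Even n) (hlam : AnalyticLambdaEq W p n)
    (hξ : CyclotomicFactorAt W p) (hA : AnalyticLamDivisorSetXi W p A)
    (hk : AlgebraicLambdaGE W p k) (hgap : ∀ d ∈ A, Even d → k ≤ d → n ≤ d + 1) :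
    LambdaPartAt W p := by
  intro κ γ hκ hγ hγ' _ f hf ϖ hϖ D g h hchar hι
  haveI : Module.Finite (IwasawaAlgebra p) D.X := D.module_finite_holds hγ
  obtain ⟨hX, -⟩ := hW16 W p hp ⟨hgood, hord⟩ hred hκ hγ hγ' hf D ϖ hϖ
  have hgh : g * h ≠ 0 := mul_ne_zero_of_iota_eq hgood hord hf hϖ D hι
  have hg : g ≠ 0 := fun h0 ↦ hgh (by rw [h0, zero_mul])
  have h1 : lam (g * h) = n := hlam f hf ϖ hϖ (g * h) hι
  have h2 : lam g = lambdaInvariant p D.X := lam_generator_eq_lambdaInvariant D.X hX hg hchar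
  have h3 : k ≤ lambdaInvariant p D.X := hk κ γ hκ hγ D hX
  have hcork : W.selmerCorank p = 0 := by
    haveI := hSel
    exact zpCorank_eq_zero_of_finite (W.selmerGroupPInfty p) p
  have heven : Even (lam g) := by
    rw [h2]
    exact prop310_selmerCorank_mod_two_eq_lambdaInvariant.even_lambdaInvariant_of_selmerCorank_eq_zero
      h310 W p hp hκ hγ D hX hcork
  have hxi : xi p ∣ g := hξ κ γ hκ hγ hγ' D g hchar
  have h4 : lam g ∈ A := hA f hf ϖ hϖ g h hι hxi
  have h5 : n ≤ lam g + 1 := hgap (lam g) h4 heven (by omega)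
  obtain ⟨a, ha⟩ := heven
  obtain ⟨b, hb⟩ := hn
  omega

/-- **Route N ∘ C: Mazur's main conjecture** from the μ-part, `λ_an = n` even, `ξ_p ∣ f_E`, the
relative divisor set, `λ_alg ≥ k`, finiteness of `Sel_{p^∞}(E/ℚ)` and the gap check.
[cite: GreenbergLNM1716, Prop. 3.10 and §5 p. 132] [cite: Wuthrich2014, Thm. 16 (p. 397)] -/
theorem mazurMainConjecture_of_lamDivisorSetXi_of_cyclotomicFactor_of_even
    (hW16 : Wuthrich2014.charIdeal_dvd_padicLFunction)
    (h310 : prop310_selmerCorank_mod_two_eq_lambdaInvariant)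
    (hp : p ≠ 2) (hgood : W.HasGoodReductionAtPrime p) (hord : ¬ (p : ℤ) ∣ W.frobeniusTrace p)
    (hred : ¬ W.HasIrreducibleModPGaloisRep p) (hSel : Finite (W.selmerGroupPInfty p))
    (hμ : MuPartAt W p) {n k : ℕ} {A : Set ℕ} (hn : Even n) (hlam : AnalyticLambdaEq W p n)
    (hξ : CyclotomicFactorAt W p) (hA : AnalyticLamDivisorSetXi W p A)
    (hk : AlgebraicLambdaGE W p k) (hgap : ∀ d ∈ A, Even d → k ≤ d → n ≤ d + 1) :
    MazurMainConjecture W p :=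
  (mazurMainConjecture_iff_muPart_and_lambdaPart hW16 hp hgood hord hred).mpr
    ⟨hμ, lambdaPartAt_of_lamDivisorSetXi_of_cyclotomicFactor_of_even hW16 h310 hp hgood hord hred
      hSel hn hlam hξ hA hk hgap⟩

end Squeeze

/-! ## §3. On the leaf X1 ∩ {r = 0} -/

section Leaf

variable {W : WeierstrassCurve ℚ} [W.IsElliptic] [W.IsGloballyMinimal] {p : ℕ} [Fact p.Prime]

/-- **Route N ∘ C on the leaf: `μ_an = 0 ∧ λ_an = n ∧ ξ_p ∣ f_E ∧ (relative divisor set A) ∧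
λ_alg ≥ k ∧ gap ⇒ BSD(E,p)`** (μ-part automatic at `μ_an = 0`; parity automatic on the leaf; all
named facts PUBLISHED). Census example: `6422f@3` (`λ_an = 6`, `P_an = ξ_3·Q_4`, `A = {2, 6}`,
`k = 3`). [cite: GreenbergLNM1716, Thm. 1.2, Prop. 3.10, Thm. 4.1 and §5 p. 132]
[cite: Wuthrich2014, Thm. 16 (p. 397)] [cite: Washington1997, Thm. 7.3 and Prop. 7.6] -/
theorem Leaf.bsdp_of_muZero_of_lamDivisorSetXi_of_cyclotomicFactor
    (hW16 : Wuthrich2014.charIdeal_dvd_padicLFunction) (hGr : greenberg_charValue_rankZero)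
    (h310 : prop310_selmerCorank_mod_two_eq_lambdaInvariant)
    (hmod : nonempty_modularParametrizationData)
    (hGZK : rank_eq_analyticRank_of_analyticRank_le_one) (hL : RankZero.Leaf W p)
    (hμ0 : AnalyticMuLE W p 0) {n k : ℕ} {A : Set ℕ} (hlam : AnalyticLambdaEq W p n)
    (hξ : CyclotomicFactorAt W p) (hA : AnalyticLamDivisorSetXi W p A)
    (hk : AlgebraicLambdaGE W p k) (hgap : ∀ d ∈ A, Even d → k ≤ d → n ≤ d + 1) : BSDp W p :=
  have hX := isClassX1_of_classX1 hL.classX1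
  (RankZero.Leaf.mazurMainConjecture_iff_bsdp hW16 hGr hmod hGZK hL).mp <|
    mazurMainConjecture_of_lamDivisorSetXi_of_cyclotomicFactor_of_even hW16 h310 hX.two_ne
      hX.hasGoodReductionAtPrime hX.not_dvd_frobeniusTrace hX.not_hasIrreducibleModPGaloisRep
      (TamagawaSqueeze.Leaf.finite_selmerGroupPInfty hmod hGZK hL)
      (muPartAt_of_analyticMuLE_zero hW16 hX.two_ne hX.hasGoodReductionAtPrime
        hX.not_dvd_frobeniusTrace hX.not_hasIrreducibleModPGaloisRep hμ0)
      (ParitySqueeze.Leaf.even_of_analyticLambdaEq hW16 hmod hL hlam) hlam hξ hA hk hgap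

end Leaf

end Summit.BirchSwinnertonDyer.Rank1Residual.X1.FactorSqueezeCyclotomic

end
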